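import Mathlib.Analysis.SpecialFunctions.Trigonometric.DerivHyp
import Mathlib.Analysis.SpecialFunctions.ExpDeriv
import Mathlib.Analysis.Calculus.MeanValue
import Mathlib.Analysis.Complex.Basic
import HarnessLib

/-!
# Logarithmic rates of the real solutions of `y″ = q y` in a forbidden region (Riccati comparison)
# and the growth sign of a complex combination dominated by one real branch

Topic `Literature/Analysis/ODE` (namespace `Literature.Analysis.ODE`), companion of `BarrierBasis.lean`
(cosh / sinh comparison for the SIZES of the end-normalised solutions) and `GrowthPairing.lean` (the
diagonal Green kernel from growth RATES). For the real equation `y″ = q(x) y` on an interval where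
`q ≥ k²` (resp. `q ≤ K²`), the LOGARITHMIC DERIVATIVE of a positive solution obeys one-sided Riccati
comparison bounds that only involve the data at ONE end — this is what makes them local (the rate at
`x` is certified by the coefficient on `[x, x + ℓ]` alone, however the solution continues beyond):

* `tanh_mul_le_neg_deriv` — RECESSIVE RATE: if `d ≥ 0` solves `d″ = q d` on `[x, β]` with `q ≥ k²`
  and `d′(β) ≤ 0`, then `k·tanh(k(β − s))·d(s) ≤ −d′(s)` for `s ∈ [x, β]` (the Wronskian of
  `d` against `cosh k(s − β)` is non-decreasing and `≤ 0` at `β`);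
* `tanh_mul_le_deriv` — the mirror GROWING RATE from the left end: `g ≥ 0`, `g″ = q g` on `[α, x]`,
  `q ≥ k²`, `g′(α) ≥ 0` give `k·tanh(k(s − α))·g(s) ≤ g′(s)`;
* `deriv_le_mul_of_coeff_le_sq` — RATE CEILING: `g ≥ 0`, `g″ = q g` on `[α, x]`, `q ≤ K²`,
  `g′(α) ≤ K g(α)` give `g′(s) ≤ K g(s)` (`e^{Ks}(g′ − Kg)` is non-increasing);
  `neg_deriv_le_mul_of_coeff_le_sq` — the mirror statement `−d′(s) ≤ K d(s)` from the right end;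
* `re_conj_mul_le_of_recessive_dominated` — ONE-POINT ALGEBRA: for complex `a, b` and reals
  `g, g′ ≥ 0`, `d ≥ 0 ≥ d′` with `|a|g ≤ ε|b|d`, `|a|g′ ≤ ε|b|(−d′)` and `r d ≤ −d′` (`r ≥ 0`), the
  combination `v = a g + b d`, `v′ = a g′ + b d′` satisfies
  `Re(v̄ v′) ≤ −((1 − 2ε − ε²)/(1 + ε)²)·r·|v|²` — a complex solution dominated by the recessive
  branch is inward-growing at (a fixed fraction of) the recessive rate;
  `re_conj_mul_ge_of_growing_dominated` — the mirror statement for a combination dominated by the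
  growing branch, `Re(ū u′) ≥ ((1 − 2ε − ε²)/(1 + ε)²)·p·|u|²` when `p g ≤ g′`.

These are the rate inputs of the growth pairing `k|u||v| ≤ |W|` (`GrowthPairing.lean`) inside the
single barrier of Carter's radial equation (near-extremal Kerr programme, threshold cone). Hypotheses
are pointwise `HasDerivAt` statements on closed intervals; no global solution is assumed. Not here:
anything about sizes (that is `BarrierBasis(_Bounds).lean`) or fluxes (`ComplexOverRealBasis.lean`).

## References
* P. Hartman, *Ordinary Differential Equations* (SIAM Classics 38, 2002), Ch. XI §3 (Sturm
  comparison in logarithmic-derivative / Riccati form, Thm. 3.2 and (3.4); the Wronskian device of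
  Ex. 3.1(a)) and §6 (principal = recessive solutions). Key `Hartman2002`.
* F. W. J. Olver, *Asymptotics and Special Functions* (1974), Ch. 6 §§1–2. Key `Olver1974`.
-/

noncomputable section

open Set
open scoped ComplexConjugate

namespace Literature.Analysis.ODE

/-! ### Recessive and growing rates: `q ≥ k²` -/

/-- **Recessive rate (Riccati comparison from the right end).** Let `d″ = q d` on `[x, β]`
(pointwise `HasDerivAt` data), `q ≥ k²` (any real `k`), `d ≥ 0` on `[x, β]` and `d′(β) ≤ 0`. Then for
every `s ∈ [x, β]`: `k·tanh(k(β − s))·d(s) ≤ −d′(s)`, i.e. the logarithmic decay rate `−d′/d` of the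
(right-)recessive branch at `s` is at least `k tanh(k(β − s))`. Proof: `Ψ = d′·cosh k(s − β) −
d·k sinh k(s − β)` has `Ψ′ = (q − k²)·d·cosh k(s − β) ≥ 0` and `Ψ(β) = d′(β) ≤ 0`.
[cite: Hartman2002, Ch. XI Thm. 3.2 and Ex. 3.1(a)] -/
theorem tanh_mul_le_neg_deriv {d d' q : ℝ → ℝ} {x β k : ℝ}
    (hd : ∀ s ∈ Icc x β, HasDerivAt d (d' s) s ∧ HasDerivAt d' (q s * d s) s)
    (hqk : ∀ s ∈ Icc x β, k ^ 2 ≤ q s) (hd0 : ∀ s ∈ Icc x β, 0 ≤ d s) (hdβ : d' β ≤ 0) :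
    ∀ s ∈ Icc x β, k * Real.tanh (k * (β - s)) * d s ≤ -d' s := by
  set Ψ : ℝ → ℝ := fun s ↦ d' s * Real.cosh (k * (s - β)) - d s * (k * Real.sinh (k * (s - β)))
    with hΨ
  have hC : ∀ s, HasDerivAt (fun s ↦ Real.cosh (k * (s - β))) (k * Real.sinh (k * (s - β))) s :=
    fun s ↦ (((hasDerivAt_id' s).sub_const β).const_mul k).cosh.congr_deriv (by ring)
  have hS : ∀ s, HasDerivAt (fun s ↦ k * Real.sinh (k * (s - β)))
      (k ^ 2 * Real.cosh (k * (s - β))) s := fun s ↦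
    ((((hasDerivAt_id' s).sub_const β).const_mul k).sinh.const_mul k).congr_deriv (by ring)
  have hΨ' : ∀ s ∈ Icc x β, HasDerivAt Ψ ((q s - k ^ 2) * d s * Real.cosh (k * (s - β))) s := by
    intro s hs
    have h := ((hd s hs).2.mul (hC s)).sub ((hd s hs).1.mul (hS s))
    refine h.congr_deriv ?_
    ring
  have hmono : MonotoneOn Ψ (Icc x β) :=
    monotoneOn_of_deriv_nonneg (convex_Icc x β)
      (fun s hs ↦ (hΨ' s hs).continuousAt.continuousWithinAt)
      (fun s hs ↦ (hΨ' s (interior_subset hs)).differentiableAt.differentiableWithinAt)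
      fun s hs ↦ by
        have hs' : s ∈ Icc x β := interior_subset hs
        rw [(hΨ' s hs').deriv]
        exact mul_nonneg (mul_nonneg (sub_nonneg.2 (hqk s hs')) (hd0 s hs')) (Real.cosh_pos _).le
  intro s hs
  have hβ : β ∈ Icc x β := right_mem_Icc.2 (hs.1.trans hs.2)
  have h1 : Ψ s ≤ Ψ β := hmono hs hβ hs.2
  have h2 : Ψ β = d' β := by simp [hΨ]
  have h3 : d' s * Real.cosh (k * (s - β)) - d s * (k * Real.sinh (k * (s - β))) ≤ 0 := by
    have : Ψ s ≤ 0 := h1.trans (h2.le.trans hdβ)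
    simpa [hΨ] using this
  -- divide by `cosh > 0`; `sinh k(s − β) = −sinh k(β − s)`, `cosh k(s − β) = cosh k(β − s)`
  have hc : 0 < Real.cosh (k * (β - s)) := Real.cosh_pos _
  have e1 : Real.cosh (k * (s - β)) = Real.cosh (k * (β - s)) := by
    rw [← Real.cosh_neg]; ring_nf
  have e2 : Real.sinh (k * (s - β)) = -Real.sinh (k * (β - s)) := by
    rw [← Real.sinh_neg]; ring_nf
  rw [e1, e2] at h3
  rw [Real.tanh_eq_sinh_div_cosh]
  have h4 : k * Real.sinh (k * (β - s)) * d s ≤ -d' s * Real.cosh (k * (β - s)) := by nlinarith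
  calc k * (Real.sinh (k * (β - s)) / Real.cosh (k * (β - s))) * d s
      = k * Real.sinh (k * (β - s)) * d s / Real.cosh (k * (β - s)) := by ring
    _ ≤ -d' s * Real.cosh (k * (β - s)) / Real.cosh (k * (β - s)) :=
        div_le_div_of_nonneg_right h4 hc.le
    _ = -d' s := by field_simp

/-- **Growing rate (Riccati comparison from the left end).** Let `g″ = q g` on `[α, x]`, `q ≥ k²`
(any real `k`), `g ≥ 0` on `[α, x]` and `g′(α) ≥ 0`. Then `k·tanh(k(s − α))·g(s) ≤ g′(s)` for every
`s ∈ [α, x]`. [cite: Hartman2002, Ch. XI Thm. 3.2 and Ex. 3.1(a)] -/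
theorem tanh_mul_le_deriv {g g' q : ℝ → ℝ} {α x k : ℝ}
    (hg : ∀ s ∈ Icc α x, HasDerivAt g (g' s) s ∧ HasDerivAt g' (q s * g s) s)
    (hqk : ∀ s ∈ Icc α x, k ^ 2 ≤ q s) (hg0 : ∀ s ∈ Icc α x, 0 ≤ g s) (hgα : 0 ≤ g' α) :
    ∀ s ∈ Icc α x, k * Real.tanh (k * (s - α)) * g s ≤ g' s := by
  set Ψ : ℝ → ℝ := fun s ↦ g' s * Real.cosh (k * (s - α)) - g s * (k * Real.sinh (k * (s - α)))
    with hΨ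
  have hC : ∀ s, HasDerivAt (fun s ↦ Real.cosh (k * (s - α))) (k * Real.sinh (k * (s - α))) s :=
    fun s ↦ (((hasDerivAt_id' s).sub_const α).const_mul k).cosh.congr_deriv (by ring)
  have hS : ∀ s, HasDerivAt (fun s ↦ k * Real.sinh (k * (s - α)))
      (k ^ 2 * Real.cosh (k * (s - α))) s := fun s ↦
    ((((hasDerivAt_id' s).sub_const α).const_mul k).sinh.const_mul k).congr_deriv (by ring)
  have hΨ' : ∀ s ∈ Icc α x, HasDerivAt Ψ ((q s - k ^ 2) * g s * Real.cosh (k * (s - α))) s := by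
    intro s hs
    have h := ((hg s hs).2.mul (hC s)).sub ((hg s hs).1.mul (hS s))
    refine h.congr_deriv ?_
    ring
  have hmono : MonotoneOn Ψ (Icc α x) :=
    monotoneOn_of_deriv_nonneg (convex_Icc α x)
      (fun s hs ↦ (hΨ' s hs).continuousAt.continuousWithinAt)
      (fun s hs ↦ (hΨ' s (interior_subset hs)).differentiableAt.differentiableWithinAt)
      fun s hs ↦ by
        have hs' : s ∈ Icc α x := interior_subset hs
        rw [(hΨ' s hs').deriv]
        exact mul_nonneg (mul_nonneg (sub_nonneg.2 (hqk s hs')) (hg0 s hs')) (Real.cosh_pos _).le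
  intro s hs
  have hα : α ∈ Icc α x := left_mem_Icc.2 (hs.1.trans hs.2)
  have h1 : Ψ α ≤ Ψ s := hmono hα hs hs.1
  have h2 : Ψ α = g' α := by simp [hΨ]
  have h3 : 0 ≤ g' s * Real.cosh (k * (s - α)) - g s * (k * Real.sinh (k * (s - α))) := by
    have : 0 ≤ Ψ s := (hgα.trans h2.ge).trans h1
    simpa [hΨ] using this
  have hc : 0 < Real.cosh (k * (s - α)) := Real.cosh_pos _
  rw [Real.tanh_eq_sinh_div_cosh]
  have h4 : k * Real.sinh (k * (s - α)) * g s ≤ g' s * Real.cosh (k * (s - α)) := by nlinarith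
  calc k * (Real.sinh (k * (s - α)) / Real.cosh (k * (s - α))) * g s
      = k * Real.sinh (k * (s - α)) * g s / Real.cosh (k * (s - α)) := by ring
    _ ≤ g' s * Real.cosh (k * (s - α)) / Real.cosh (k * (s - α)) :=
        div_le_div_of_nonneg_right h4 hc.le
    _ = g' s := by field_simp

/-! ### Rate ceilings: `q ≤ K²` -/

/-- **Growth-rate ceiling from the left end.** Let `g″ = q g` on `[α, x]`, `q ≤ K²` (any real `K`),
`g ≥ 0` there and `g′(α) ≤ K g(α)`. Then `g′(s) ≤ K g(s)` for every `s ∈ [α, x]`: the function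
`e^{Ks}(g′ − K g)` has derivative `e^{Ks}(q − K²) g ≤ 0`. [cite: Hartman2002, Ch. XI Thm. 3.2] -/
theorem deriv_le_mul_of_coeff_le_sq {g g' q : ℝ → ℝ} {α x K : ℝ}
    (hg : ∀ s ∈ Icc α x, HasDerivAt g (g' s) s ∧ HasDerivAt g' (q s * g s) s)
    (hqK : ∀ s ∈ Icc α x, q s ≤ K ^ 2) (hg0 : ∀ s ∈ Icc α x, 0 ≤ g s) (hgα : g' α ≤ K * g α) :
    ∀ s ∈ Icc α x, g' s ≤ K * g s := by
  set Ψ : ℝ → ℝ := fun s ↦ Real.exp (K * s) * (g' s - K * g s) with hΨ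
  have hE : ∀ s, HasDerivAt (fun s ↦ Real.exp (K * s)) (Real.exp (K * s) * K) s := fun s ↦
    ((hasDerivAt_id' s).const_mul K |>.congr_deriv (by ring)).exp
  have hΨ' : ∀ s ∈ Icc α x, HasDerivAt Ψ (Real.exp (K * s) * ((q s - K ^ 2) * g s)) s := by
    intro s hs
    have h1 : HasDerivAt (fun y ↦ g' y - K * g y) (q s * g s - K * g' s) s :=
      (hg s hs).2.sub ((hg s hs).1.const_mul K)
    have h := (hE s).mul h1
    refine h.congr_deriv ?_
    ring
  have hanti : AntitoneOn Ψ (Icc α x) :=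
    antitoneOn_of_deriv_nonpos (convex_Icc α x)
      (fun s hs ↦ (hΨ' s hs).continuousAt.continuousWithinAt)
      (fun s hs ↦ (hΨ' s (interior_subset hs)).differentiableAt.differentiableWithinAt)
      fun s hs ↦ by
        have hs' : s ∈ Icc α x := interior_subset hs
        rw [(hΨ' s hs').deriv]
        have : (q s - K ^ 2) * g s ≤ 0 :=
          mul_nonpos_of_nonpos_of_nonneg (sub_nonpos.2 (hqK s hs')) (hg0 s hs')
        exact mul_nonpos_of_nonneg_of_nonpos (Real.exp_pos _).le this
  intro s hs
  have hα : α ∈ Icc α x := left_mem_Icc.2 (hs.1.trans hs.2)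
  have h1 : Ψ s ≤ Ψ α := hanti hα hs hs.1
  have h2 : Ψ α ≤ 0 :=
    mul_nonpos_of_nonneg_of_nonpos (Real.exp_pos _).le (sub_nonpos.2 hgα)
  have h3 : Real.exp (K * s) * (g' s - K * g s) ≤ 0 := h1.trans h2
  have h4 : g' s - K * g s ≤ 0 := by
    by_contra hcon
    push Not at hcon
    have : 0 < Real.exp (K * s) * (g' s - K * g s) := mul_pos (Real.exp_pos _) hcon
    linarith
  linarith

/-- **Decay-rate ceiling from the right end.** Let `d″ = q d` on `[x, β]`, `q ≤ K²` (any real `K`),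
`d ≥ 0` there and `−d′(β) ≤ K d(β)`. Then `−d′(s) ≤ K d(s)` for every `s ∈ [x, β]`
(`e^{−Ks}(d′ + K d)` is non-decreasing). [cite: Hartman2002, Ch. XI Thm. 3.2] -/
theorem neg_deriv_le_mul_of_coeff_le_sq {d d' q : ℝ → ℝ} {x β K : ℝ}
    (hd : ∀ s ∈ Icc x β, HasDerivAt d (d' s) s ∧ HasDerivAt d' (q s * d s) s)
    (hqK : ∀ s ∈ Icc x β, q s ≤ K ^ 2) (hd0 : ∀ s ∈ Icc x β, 0 ≤ d s) (hdβ : -d' β ≤ K * d β) :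
    ∀ s ∈ Icc x β, -d' s ≤ K * d s := by
  set Ψ : ℝ → ℝ := fun s ↦ Real.exp (-(K * s)) * (d' s + K * d s) with hΨ
  have hE : ∀ s, HasDerivAt (fun s ↦ Real.exp (-(K * s))) (Real.exp (-(K * s)) * (-K)) s :=
    fun s ↦ (((hasDerivAt_id' s).const_mul K).neg |>.congr_deriv (by ring)).exp
  have hΨ' : ∀ s ∈ Icc x β, HasDerivAt Ψ (Real.exp (-(K * s)) * ((q s - K ^ 2) * d s)) s := by
    intro s hs
    have h1 : HasDerivAt (fun y ↦ d' y + K * d y) (q s * d s + K * d' s) s :=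
      (hd s hs).2.add ((hd s hs).1.const_mul K)
    have h := (hE s).mul h1
    refine h.congr_deriv ?_
    ring
  have hanti : AntitoneOn Ψ (Icc x β) :=
    antitoneOn_of_deriv_nonpos (convex_Icc x β)
      (fun s hs ↦ (hΨ' s hs).continuousAt.continuousWithinAt)
      (fun s hs ↦ (hΨ' s (interior_subset hs)).differentiableAt.differentiableWithinAt)
      fun s hs ↦ by
        have hs' : s ∈ Icc x β := interior_subset hs
        rw [(hΨ' s hs').deriv]
        have : (q s - K ^ 2) * d s ≤ 0 :=
          mul_nonpos_of_nonpos_of_nonneg (sub_nonpos.2 (hqK s hs')) (hd0 s hs')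
        exact mul_nonpos_of_nonneg_of_nonpos (Real.exp_pos _).le this
  intro s hs
  have hβ : β ∈ Icc x β := right_mem_Icc.2 (hs.1.trans hs.2)
  have h1 : Ψ β ≤ Ψ s := hanti hs hβ hs.2
  have h2 : 0 ≤ Ψ β := mul_nonneg (Real.exp_pos _).le (by linarith)
  have h3 : 0 ≤ Real.exp (-(K * s)) * (d' s + K * d s) := h2.trans h1
  have h4 : 0 ≤ d' s + K * d s := by
    by_contra hcon
    push Not at hcon
    have : Real.exp (-(K * s)) * (d' s + K * d s) < 0 := mul_neg_of_pos_of_neg (Real.exp_pos _) hcon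
    linarith
  linarith

/-! ### One-point algebra: a combination dominated by one real branch keeps its growth sign -/

/-- `|Re(ā b)| ≤ |a||b|` in the form `Re(ā b)·t ≤ |a||b|·|t|`. [folklore] -/
private theorem re_conj_mul_mul_le (a b : ℂ) (t : ℝ) : (conj a * b).re * t ≤ ‖a‖ * ‖b‖ * |t| := by
  have h1 : |(conj a * b).re| ≤ ‖a‖ * ‖b‖ := by
    calc |(conj a * b).re| ≤ ‖conj a * b‖ := Complex.abs_re_le_norm _
      _ = ‖a‖ * ‖b‖ := by rw [norm_mul, Complex.norm_conj]
  calc (conj a * b).re * t ≤ |(conj a * b).re * t| := le_abs_self _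
    _ = |(conj a * b).re| * |t| := abs_mul _ _
    _ ≤ ‖a‖ * ‖b‖ * |t| := mul_le_mul_of_nonneg_right h1 (abs_nonneg _)

/-- The real part of `conj(a g + b d)·(a g′ + b d′)` for real `g, g′, d, d′`:
`|a|² g g′ + |b|² d d′ + Re(ā b)(g d′ + d g′)`. [folklore] -/
theorem re_conj_combination_mul (a b : ℂ) (g g' d d' : ℝ) :
    (conj (a * g + b * d) * (a * g' + b * d')).re =
      ‖a‖ ^ 2 * (g * g') + ‖b‖ ^ 2 * (d * d') + (conj a * b).re * (g * d' + d * g') := by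
  have ha : ‖a‖ ^ 2 = a.re ^ 2 + a.im ^ 2 := by rw [Complex.sq_norm, Complex.normSq_apply]; ring
  have hb : ‖b‖ ^ 2 = b.re ^ 2 + b.im ^ 2 := by rw [Complex.sq_norm, Complex.normSq_apply]; ring
  simp only [map_add, map_mul, Complex.conj_ofReal, Complex.add_re, Complex.add_im, Complex.mul_re,
    Complex.mul_im, Complex.ofReal_re, Complex.ofReal_im, Complex.conj_re, Complex.conj_im]
  rw [ha, hb]
  ring

/-- **A recessive-dominated combination is inward-growing.** Let `a, b ∈ ℂ`, reals `g, g′ ≥ 0`,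
`d ≥ 0`, `d′ ≤ 0`, `0 ≤ ε` with `1 − 2ε − ε² ≥ 0`, and suppose the `g`-component is `ε`-small against
the `d`-component in value and in derivative, `|a| g ≤ ε·|b| d`, `|a| g′ ≤ ε·|b|(−d′)`, and `d` decays
at rate at least `r ≥ 0`, `r d ≤ −d′`. Then `v = a g + b d`, `v′ = a g′ + b d′` satisfy
`Re(v̄ v′) ≤ −((1 − 2ε − ε²)/(1 + ε)²)·r·|v|²`. [folklore] -/
theorem re_conj_mul_le_of_recessive_dominated {a b : ℂ} {g g' d d' ε r : ℝ} (hg : 0 ≤ g)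
    (hg' : 0 ≤ g') (hd : 0 ≤ d) (hd' : d' ≤ 0) (hε : 0 ≤ ε) (hε1 : 0 ≤ 1 - 2 * ε - ε ^ 2)
    (hr : 0 ≤ r) (h1 : ‖a‖ * g ≤ ε * (‖b‖ * d)) (h2 : ‖a‖ * g' ≤ ε * (‖b‖ * -d'))
    (hrd : r * d ≤ -d') :
    (conj (a * g + b * d) * (a * g' + b * d')).re ≤
      -((1 - 2 * ε - ε ^ 2) / (1 + ε) ^ 2) * r * ‖a * g + b * d‖ ^ 2 := by
  set X := ‖b‖ * d with hX
  set R := ‖b‖ * -d' with hR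
  set Y := ‖a‖ * g with hY
  set Y' := ‖a‖ * g' with hY'
  have hX0 : 0 ≤ X := mul_nonneg (norm_nonneg _) hd
  have hR0 : 0 ≤ R := mul_nonneg (norm_nonneg _) (by linarith)
  have hY0 : 0 ≤ Y := mul_nonneg (norm_nonneg _) hg
  have hY'0 : 0 ≤ Y' := mul_nonneg (norm_nonneg _) hg'
  rw [re_conj_combination_mul]
  -- the three signed terms
  have t1 : ‖a‖ ^ 2 * (g * g') = Y * Y' := by rw [hY, hY']; ring
  have t2 : ‖b‖ ^ 2 * (d * d') = -(X * R) := by rw [hX, hR]; ring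
  have t3 : (conj a * b).re * (g * d' + d * g') ≤ Y * R + X * Y' := by
    have e1 := re_conj_mul_mul_le a b (g * d')
    have e2 := re_conj_mul_mul_le a b (d * g')
    have e3 : |g * d'| = g * -d' := by
      rw [abs_mul, abs_of_nonneg hg, abs_of_nonpos hd']
    have e4 : |d * g'| = d * g' := abs_of_nonneg (mul_nonneg hd hg')
    rw [e3] at e1; rw [e4] at e2
    calc (conj a * b).re * (g * d' + d * g') = (conj a * b).re * (g * d') + (conj a * b).re * (d * g') := by
          ring
      _ ≤ ‖a‖ * ‖b‖ * (g * -d') + ‖a‖ * ‖b‖ * (d * g') := add_le_add e1 e2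
      _ = Y * R + X * Y' := by rw [hY, hR, hX, hY']; ring
  -- smallness: `Y ≤ εX`, `Y' ≤ εR`
  have hYX : Y ≤ ε * X := h1
  have hY'R : Y' ≤ ε * R := h2
  have hmain : Y * Y' + -(X * R) + (Y * R + X * Y') ≤ -((1 - 2 * ε - ε ^ 2) * (X * R)) := by
    have a1 : Y * Y' ≤ ε * X * (ε * R) := mul_le_mul hYX hY'R hY'0 (by positivity)
    have a2 : Y * R ≤ ε * X * R := mul_le_mul_of_nonneg_right hYX hR0
    have a3 : X * Y' ≤ X * (ε * R) := mul_le_mul_of_nonneg_left hY'R hX0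
    nlinarith
  -- `X R ≥ r X²` and `|v| ≤ (1 + ε) X`
  have hXR : r * X ^ 2 ≤ X * R := by
    have : r * d * ‖b‖ ≤ -d' * ‖b‖ := mul_le_mul_of_nonneg_right hrd (norm_nonneg _)
    rw [hX, hR]; nlinarith [norm_nonneg b, hd]
  have hv : ‖a * g + b * d‖ ≤ (1 + ε) * X := by
    calc ‖a * (g : ℂ) + b * (d : ℂ)‖ ≤ ‖a * (g : ℂ)‖ + ‖b * (d : ℂ)‖ := norm_add_le _ _
      _ = Y + X := by
          rw [norm_mul, norm_mul, Complex.norm_real, Complex.norm_real, Real.norm_eq_abs,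
            Real.norm_eq_abs, abs_of_nonneg hg, abs_of_nonneg hd]
      _ ≤ ε * X + X := by linarith
      _ = (1 + ε) * X := by ring
  have hv2 : ‖a * g + b * d‖ ^ 2 ≤ (1 + ε) ^ 2 * X ^ 2 := by
    have := pow_le_pow_left₀ (norm_nonneg _) hv 2
    rw [mul_pow] at this; exact this
  have hε2 : 0 < (1 + ε) ^ 2 := by positivity
  have hc0 : 0 ≤ (1 - 2 * ε - ε ^ 2) / (1 + ε) ^ 2 * r := by positivity
  rw [t1, t2]
  calc Y * Y' + -(X * R) + (conj a * b).re * (g * d' + d * g')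
      ≤ Y * Y' + -(X * R) + (Y * R + X * Y') := by linarith
    _ ≤ -((1 - 2 * ε - ε ^ 2) * (X * R)) := hmain
    _ ≤ -((1 - 2 * ε - ε ^ 2) * (r * X ^ 2)) := by nlinarith
    _ = -((1 - 2 * ε - ε ^ 2) / (1 + ε) ^ 2 * r) * ((1 + ε) ^ 2 * X ^ 2) := by
        field_simp
    _ ≤ -((1 - 2 * ε - ε ^ 2) / (1 + ε) ^ 2 * r) * ‖a * g + b * d‖ ^ 2 := by
        rw [neg_mul, neg_mul, neg_le_neg_iff]
        exact mul_le_mul_of_nonneg_left hv2 hc0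
    _ = -((1 - 2 * ε - ε ^ 2) / (1 + ε) ^ 2) * r * ‖a * g + b * d‖ ^ 2 := by ring

/-- **A growing-dominated combination is outward-growing** (mirror of
`re_conj_mul_le_of_recessive_dominated`): with `g ≥ 0`, `g′ ≥ 0`, `d ≥ 0`, `d′ ≤ 0`, the
`d`-component `ε`-small against the `g`-component, `|b| d ≤ ε·|a| g`, `|b|(−d′) ≤ ε·|a| g′`, and `g`
growing at rate at least `p ≥ 0`, `p g ≤ g′`: the combination `u = a g + b d`, `u′ = a g′ + b d′`
satisfies `((1 − 2ε − ε²)/(1 + ε)²)·p·|u|² ≤ Re(ū u′)`. [folklore] -/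
theorem re_conj_mul_ge_of_growing_dominated {a b : ℂ} {g g' d d' ε p : ℝ} (hg : 0 ≤ g)
    (hg' : 0 ≤ g') (hd : 0 ≤ d) (hd' : d' ≤ 0) (hε : 0 ≤ ε) (hε1 : 0 ≤ 1 - 2 * ε - ε ^ 2)
    (hp : 0 ≤ p) (h1 : ‖b‖ * d ≤ ε * (‖a‖ * g)) (h2 : ‖b‖ * -d' ≤ ε * (‖a‖ * g'))
    (hpg : p * g ≤ g') :
    (1 - 2 * ε - ε ^ 2) / (1 + ε) ^ 2 * p * ‖a * g + b * d‖ ^ 2 ≤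
      (conj (a * g + b * d) * (a * g' + b * d')).re := by
  set X := ‖a‖ * g with hX
  set R := ‖a‖ * g' with hR
  set Y := ‖b‖ * d with hY
  set Y' := ‖b‖ * -d' with hY'
  have hX0 : 0 ≤ X := mul_nonneg (norm_nonneg _) hg
  have hR0 : 0 ≤ R := mul_nonneg (norm_nonneg _) hg'
  have hY0 : 0 ≤ Y := mul_nonneg (norm_nonneg _) hd
  have hY'0 : 0 ≤ Y' := mul_nonneg (norm_nonneg _) (by linarith)
  rw [re_conj_combination_mul]
  have t1 : ‖a‖ ^ 2 * (g * g') = X * R := by rw [hX, hR]; ring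
  have t2 : ‖b‖ ^ 2 * (d * d') = -(Y * Y') := by rw [hY, hY']; ring
  have t3 : -(X * Y' + Y * R) ≤ (conj a * b).re * (g * d' + d * g') := by
    have e1 := re_conj_mul_mul_le a b (-(g * d'))
    have e2 := re_conj_mul_mul_le a b (-(d * g'))
    have e3 : |-(g * d')| = g * -d' := by
      rw [abs_neg, abs_mul, abs_of_nonneg hg, abs_of_nonpos hd']
    have e4 : |-(d * g')| = d * g' := by rw [abs_neg]; exact abs_of_nonneg (mul_nonneg hd hg')
    rw [e3] at e1; rw [e4] at e2
    have : -((conj a * b).re * (g * d' + d * g')) ≤ X * Y' + Y * R := by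
      calc -((conj a * b).re * (g * d' + d * g'))
          = (conj a * b).re * -(g * d') + (conj a * b).re * -(d * g') := by ring
        _ ≤ ‖a‖ * ‖b‖ * (g * -d') + ‖a‖ * ‖b‖ * (d * g') := add_le_add e1 e2
        _ = X * Y' + Y * R := by rw [hX, hY', hY, hR]; ring
    linarith
  have hYX : Y ≤ ε * X := h1
  have hY'R : Y' ≤ ε * R := h2
  have hmain : (1 - 2 * ε - ε ^ 2) * (X * R) ≤ X * R + -(Y * Y') + -(X * Y' + Y * R) := by
    have a1 : Y * Y' ≤ ε * X * (ε * R) := mul_le_mul hYX hY'R hY'0 (by positivity)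
    have a2 : Y * R ≤ ε * X * R := mul_le_mul_of_nonneg_right hYX hR0
    have a3 : X * Y' ≤ X * (ε * R) := mul_le_mul_of_nonneg_left hY'R hX0
    nlinarith
  have hXR : p * X ^ 2 ≤ X * R := by
    have : p * g * ‖a‖ ≤ g' * ‖a‖ := mul_le_mul_of_nonneg_right hpg (norm_nonneg _)
    rw [hX, hR]; nlinarith [norm_nonneg a, hg]
  have hv : ‖a * g + b * d‖ ≤ (1 + ε) * X := by
    calc ‖a * (g : ℂ) + b * (d : ℂ)‖ ≤ ‖a * (g : ℂ)‖ + ‖b * (d : ℂ)‖ := norm_add_le _ _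
      _ = X + Y := by
          rw [norm_mul, norm_mul, Complex.norm_real, Complex.norm_real, Real.norm_eq_abs,
            Real.norm_eq_abs, abs_of_nonneg hg, abs_of_nonneg hd]
      _ ≤ X + ε * X := by linarith
      _ = (1 + ε) * X := by ring
  have hv2 : ‖a * g + b * d‖ ^ 2 ≤ (1 + ε) ^ 2 * X ^ 2 := by
    have := pow_le_pow_left₀ (norm_nonneg _) hv 2
    rw [mul_pow] at this; exact this
  have hε2 : 0 < (1 + ε) ^ 2 := by positivity
  have hc0 : 0 ≤ (1 - 2 * ε - ε ^ 2) / (1 + ε) ^ 2 * p := by positivity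
  rw [t1, t2]
  calc (1 - 2 * ε - ε ^ 2) / (1 + ε) ^ 2 * p * ‖a * g + b * d‖ ^ 2
      ≤ (1 - 2 * ε - ε ^ 2) / (1 + ε) ^ 2 * p * ((1 + ε) ^ 2 * X ^ 2) :=
        mul_le_mul_of_nonneg_left hv2 hc0
    _ = (1 - 2 * ε - ε ^ 2) * (p * X ^ 2) := by field_simp
    _ ≤ (1 - 2 * ε - ε ^ 2) * (X * R) := mul_le_mul_of_nonneg_left hXR hε1
    _ ≤ X * R + -(Y * Y') + -(X * Y' + Y * R) := hmain
    _ ≤ X * R + -(Y * Y') + (conj a * b).re * (g * d' + d * g') := by linarith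

end Literature.Analysis.ODE

end
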